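import Summits.QuantumAdvantage.QuantumAdvantage.Theorems.CubicForrelationNearExactIsExactTwelveLevelSixGammaSmall
import Summits.QuantumAdvantage.QuantumAdvantage.Theorems.CubicForrelationNearExactIsExactTwelveLevelSixEFlat

/-!
# Crux `CubicForrelation.NearExactIsExact` (stmt-QuantumAdvantage-14043) — n = 12 AT `Φ = 29/32`, level-6 configuration (γ):
  FIVE-flat sums of the residual are `≡ 0 (mod 4)`, hence (H3) on the 9-flat `Z` and the LINE congruence on every off-`Z` 4-flat —
  for ANY residual with off-flat energy `≤ 256`

Certificate seat `b2b-cforr-cert` (gen 25).  HONEST FRAMING: finite-slice lemmas (standard axioms, no `decide`) about cubic Boolean pairs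
on 12 bits; bricks for killing the residual configuration (γ) (`#Z = 512`, `e = ±1` on the 9-flat `Z`, off-flat energy `256`) of
`tw23_boundary_reduction2`; they do NOT decide (γ) and claim NO value of `θ₁₂`.  NOT summit progress.  Plan: HOME/b2b-cforr-cert-g25/
PROOF-N12-928-GAMMA.md.

THE NEW OBSERVATION.  For cubic `g` with `W_g = 64u''` and cubic `f`, the residual `e = u'' − (−1)^f` has EVERY parametrised 5-flat sum
`≡ 0 (mod 4)` (`gh_flat5`: `fs_flat_sum_dvd` with `u = 4u''`, `k = 5`, `4 + 4 ≤ 5 + ⌈7/3⌉`, and Ax on the 5-flat for `(−1)^f`).  Gens 13–23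
used 6-flats for `mod 4` (three transversal directions); with 5-flats TWO transversal directions suffice, and the translates to be kept away
from the set `A = {x ∉ Z : 4 ∤ e(x)}` (at most `64` points when the off-flat energy is `≤ 256`, as `e` is even off `Z`) are few enough for a
plain counting choice — no hypothesis on the POSITION of the bad points is needed any more (compare `sm_H34_small`: `≤ 31` bad points).

* `gh_flat_dvd`, `gh_flat5`: `2^e ∣ Σ_{k-flat} e` in the admissible range, in particular `4 ∣ Σ_{5-flat} e` (any base, any directions);
  the 6- and 7-flat cases are gen 15's `tw15_e_flat6` / `tw15_e_flat7`.
* `gh_even_off`: `e` is even off `Z`;  `gh_A_card`: `4·#A ≤ Σ_{x∉Z} e²`;  `gh_avoid2`: two transversal directions avoiding `Z ∪ A`.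
* `gh_H3`: (H3) `4 ∣ Σ_{3-flat ⊂ Z} e` whenever `Σ_{x ∉ Z} e² ≤ 256`.
* `gh_line`: for every 4-flat `b ⊕ ⟨a₀..a₃⟩` inside an OFF-`Z` coset (`b ∉ Z`, `aᵢ ∈ V₀`): `4 ∣ Σ e` (6-flat `x_Z ⊕ ⟨x_Z⊕b, t₂, a⟩`: the base
  4-flat in `Z` is `≡ 0 (mod 4)` by (H3) twice, the `t₂`- and `t₂t₁`-translates avoid `Z ∪ A`).  Consequence (next file): `A` meets every
  off-`Z` coset in `0` or `≥ 64` points (`ws_erm_round`), so `A = ∅` or `A` is one 64-set carrying the whole off-flat energy.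

References: J. Ax (1964) / R. J. McEliece (1972); MacWilliams–Sloane (1977) Ch. 13 §3, Ch. 15 §2.  Axioms: the standard three.
-/

set_option linter.dupNamespace false -- D-0017: single-problem summit ⇒ `QuantumAdvantage.QuantumAdvantage` by design

noncomputable section

namespace Summit.QuantumAdvantage.QuantumAdvantage.Theorems.CubicForrelation.NearExactIsExact

open Finset
open Literature.Computability.QuantumComplexity
open Literature.Computability.QuantumComplexity.BuzetChailloux (bxor zeroVec bxor_bxor_cancel_left bxor_zeroVec zeroVec_bxor bxor_comm
  bxor_self)
open Literature.Computability.QuantumComplexity.DerivativeWalsh (W)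

/-! ### Flat sums of the residual `e = u'' − (−1)^f` -/

/-- **Flat sums of the residual.**  For cubic `f, g` with `W_g = 64u''`, any base point and any `k` directions:
`2^e ∣ Σ_ε (u'' − (−1)^f)(b ⊕ ε·a)` whenever `6 + e ≤ k + ⌈(12−k)/3⌉` (`fs_flat_sum_dvd`) and `e ≤ ⌈k/3⌉` (Ax for `(−1)^f` on the flat,
`sl_sum_sZ_flat`). [this work] -/
theorem gh_flat_dvd {k e : ℕ} (f g : (Fin (6 + 6) → Bool) → Bool) (hf : IsDegLeFun 3 f) (hg : IsDegLeFun 3 g)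
    (u'' : (Fin (6 + 6) → Bool) → ℤ) (hu'' : ∀ x, W (fun y => signOf (g y)) x = (2 : ℝ) ^ 6 * (u'' x : ℝ))
    (b : Fin (6 + 6) → Bool) (a : Fin k → Fin (6 + 6) → Bool) (he : 6 + e ≤ k + (6 + 6 - k + 2) / 3) (he' : e ≤ (k + 2) / 3) :
    (2 : ℤ) ^ e ∣ ∑ ε : Fin k → Bool, (u'' (fun j => b j ^^ decide (Odd #(univ.filter fun i => ε i && a i j))) -
      sZ (f (fun j => b j ^^ decide (Odd #(univ.filter fun i => ε i && a i j))))) := by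
  classical
  have h1 := fs_flat_sum_dvd (e := e) g u'' hg hu'' b a he
  obtain ⟨zf, hzf⟩ := sl_sum_sZ_flat f hf b a
  rw [sum_sub_distrib, hzf]
  refine dvd_sub h1 (Dvd.dvd.mul_right (pow_dvd_pow 2 he') zf)

/-- **(H5)**: `4 ∣ Σ_{5-flat} (u'' − (−1)^f)` (any base point, any five directions; `6 + 2 ≤ 5 + 3`, `2 ≤ ⌈5/3⌉`). [this work] -/
theorem gh_flat5 (f g : (Fin (6 + 6) → Bool) → Bool) (hf : IsDegLeFun 3 f) (hg : IsDegLeFun 3 g)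
    (u'' : (Fin (6 + 6) → Bool) → ℤ) (hu'' : ∀ x, W (fun y => signOf (g y)) x = (2 : ℝ) ^ 6 * (u'' x : ℝ))
    (b : Fin (6 + 6) → Bool) (a : Fin 5 → Fin (6 + 6) → Bool) :
    (4 : ℤ) ∣ ∑ ε : Fin 5 → Bool, (u'' (fun j => b j ^^ decide (Odd #(univ.filter fun i => ε i && a i j))) -
      sZ (f (fun j => b j ^^ decide (Odd #(univ.filter fun i => ε i && a i j))))) := by
  have h := gh_flat_dvd (e := 2) f g hf hg u'' hu'' b a (by norm_num) (by norm_num)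
  rwa [show ((2 : ℤ) ^ 2) = 4 by norm_num] at h

/-! ### The residual off `Z`: even, and the set `A = {4 ∤ e}` is small -/

/-- Off `Z = {u'' even}` the residual `u'' − (−1)^f` is even. [folklore] -/
theorem gh_even_off (f : (Fin (6 + 6) → Bool) → Bool) (u'' : (Fin (6 + 6) → Bool) → ℤ) (y : Fin (6 + 6) → Bool)
    (hy : y ∉ (univ.filter fun x : Fin (6 + 6) → Bool => ¬ Odd (u'' x))) : Even (u'' y - sZ (f y)) := by
  have hodd : Odd (u'' y) := by
    by_contra h
    exact hy (mem_filter.2 ⟨mem_univ _, h⟩)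
  rcases tp_sZ_cases (f y) with hs | hs <;> rw [hs]
  · exact Int.even_sub.2 (iff_of_false (Int.not_even_iff_odd.2 hodd) (by decide))
  · exact Int.even_sub.2 (iff_of_false (Int.not_even_iff_odd.2 hodd) (by decide))

/-- **The bad set is small**: `4·#{x ∉ Z : 4 ∤ e(x)} ≤ Σ_{x ∉ Z} e(x)²` (each such `e(x)` is even and non-zero). [this work] -/
theorem gh_A_card (f : (Fin (6 + 6) → Bool) → Bool) (u'' : (Fin (6 + 6) → Bool) → ℤ) :
    (4 : ℤ) * #(univ.filter fun y : Fin (6 + 6) → Bool => y ∉ (univ.filter fun x : Fin (6 + 6) → Bool => ¬ Odd (u'' x)) ∧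
        ¬ (4 : ℤ) ∣ u'' y - sZ (f y)) ≤
      ∑ y ∈ univ.filter (fun y => y ∉ (univ.filter fun x : Fin (6 + 6) → Bool => ¬ Odd (u'' x))), (u'' y - sZ (f y)) ^ 2 := by
  classical
  set Z := (univ.filter fun x : Fin (6 + 6) → Bool => ¬ Odd (u'' x)) with hZdef
  set A := (univ.filter fun y : Fin (6 + 6) → Bool => y ∉ Z ∧ ¬ (4 : ℤ) ∣ u'' y - sZ (f y)) with hAdef
  have h4 : ∀ y ∈ A, (4 : ℤ) ≤ (u'' y - sZ (f y)) ^ 2 := by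
    intro y hy
    obtain ⟨hyZ, hy4⟩ := (mem_filter.1 hy).2
    obtain ⟨m, hm⟩ := gh_even_off f u'' y hyZ
    have hm0 : m ≠ 0 := by
      rintro rfl
      apply hy4
      rw [hm]; exact ⟨0, by ring⟩
    have : u'' y - sZ (f y) ≤ -2 ∨ 2 ≤ u'' y - sZ (f y) := by omega
    have := tp_sq_ge (k := 2) (by norm_num) this
    linarith
  calc (4 : ℤ) * #A = ∑ y ∈ A, (4 : ℤ) := by rw [sum_const, nsmul_eq_mul, mul_comm]
    _ ≤ ∑ y ∈ A, (u'' y - sZ (f y)) ^ 2 := sum_le_sum h4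
    _ ≤ ∑ y ∈ univ.filter (fun y => y ∉ Z), (u'' y - sZ (f y)) ^ 2 :=
        sum_le_sum_of_subset_of_nonneg (fun y hy => mem_filter.2 ⟨mem_univ _, (mem_filter.1 hy).2.1⟩) fun _ _ _ => sq_nonneg _

/-! ### Two transversal directions avoiding `Z ∪ A` -/

/-- For a coset `S = x_Z ⊕ V₀` of an xor-closed `V₀`: `q ∈ S` and `q ⊕ w ∈ S` force `w ∈ V₀`. [folklore] -/
theorem gh_mem_dir (V₀ S : Finset (Fin (6 + 6) → Bool)) (xZ : Fin (6 + 6) → Bool)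
    (hadd : ∀ a ∈ V₀, ∀ b ∈ V₀, bxor a b ∈ V₀) (hS : S = V₀.image (bxor xZ))
    {q w : Fin (6 + 6) → Bool} (hq : q ∈ S) (h : bxor q w ∈ S) : w ∈ V₀ := by
  rw [hS] at hq h
  obtain ⟨v, hv, rfl⟩ := mem_image.1 hq
  obtain ⟨v', hv', he⟩ := mem_image.1 h
  have ew : w = bxor v v' := by
    funext j
    have h1 := congrFun he j
    simp only [bxor] at h1 ⊢
    revert h1
    cases xZ j <;> cases v j <;> cases v' j <;> cases w j <;> decide
  rw [ew]; exact hadd v hv v' hv'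

/-- **Two avoiding transversal directions.**  `S = x_Z ⊕ V₀` a 9-flat (`#V₀ = 512`), `A` any set with `#A ≤ 64`, `pt` any family of at most
`16` points of `S` (a parametrised flat); then there are `t₁, t₂` such that the three translate families `pt ⊕ t₁`, `pt ⊕ t₂`,
`pt ⊕ t₂ ⊕ t₁` avoid `S` and `A` (each step forbids at most `1536 + 1536 < 4096` vectors). [this work] -/
theorem gh_avoid2 (V₀ S : Finset (Fin (6 + 6) → Bool)) (xZ : Fin (6 + 6) → Bool)
    (hadd : ∀ a ∈ V₀, ∀ b ∈ V₀, bxor a b ∈ V₀) (hcardV : #V₀ = 512) (hS : S = V₀.image (bxor xZ))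
    (A : Finset (Fin (6 + 6) → Bool)) (hA : #A ≤ 64)
    {k : ℕ} (hk : 2 ^ k ≤ 16) (pt : (Fin k → Bool) → (Fin (6 + 6) → Bool)) (hpt : ∀ ε, pt ε ∈ S) :
    ∃ t₁ t₂ : Fin (6 + 6) → Bool, ∀ ε : Fin k → Bool,
      (bxor (pt ε) t₁ ∉ S ∧ bxor (pt ε) t₁ ∉ A) ∧ (bxor (pt ε) t₂ ∉ S ∧ bxor (pt ε) t₂ ∉ A) ∧
      (bxor (bxor (pt ε) t₂) t₁ ∉ S ∧ bxor (bxor (pt ε) t₂) t₁ ∉ A) := by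
  classical
  set Bad₀ := (univ : Finset (Fin k → Bool)).biUnion (fun ε => A.image (bxor (pt ε))) with hBad₀
  have hBad₀card : #Bad₀ ≤ 1024 := by
    calc #Bad₀ ≤ ∑ ε : Fin k → Bool, #(A.image (bxor (pt ε))) := card_biUnion_le
      _ ≤ ∑ ε : Fin k → Bool, #A := sum_le_sum fun ε _ => card_image_le
      _ = 2 ^ k * #A := by rw [sum_const, card_univ, Fintype.card_fun, Fintype.card_bool, Fintype.card_fin, smul_eq_mul]
      _ ≤ 16 * 64 := Nat.mul_le_mul hk hA
      _ = 1024 := by norm_num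
  set F₁ := V₀ ∪ Bad₀ with hF₁
  have hF₁card : #F₁ ≤ 1536 := (card_union_le _ _).trans (by rw [hcardV]; omega)
  have hgood : ∀ w, w ∉ F₁ → ∀ ε, bxor (pt ε) w ∉ S ∧ bxor (pt ε) w ∉ A := by
    intro w hw ε
    rw [hF₁, mem_union, not_or] at hw
    refine ⟨fun h => hw.1 (gh_mem_dir V₀ S xZ hadd hS (hpt ε) h), fun h => hw.2 ?_⟩
    exact mem_biUnion.2 ⟨ε, mem_univ _, mem_image.2 ⟨bxor (pt ε) w, h, bxor_bxor_cancel_left _ _⟩⟩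
  have hshift : ∀ w t : Fin (6 + 6) → Bool, w ∉ F₁.image (fun z => bxor z t) → bxor w t ∉ F₁ := by
    intro w t hw hmem
    exact hw (mem_image.2 ⟨bxor w t, hmem, by rw [iw_bxor_assoc, bxor_self, bxor_zeroVec]⟩)
  have huniv : #(univ : Finset (Fin (6 + 6) → Bool)) = 4096 := by
    rw [card_univ, Fintype.card_fun, Fintype.card_bool, Fintype.card_fin]; norm_num
  obtain ⟨t₁, -, ht₁⟩ : ∃ t, t ∈ univ ∧ t ∉ F₁ := exists_mem_notMem_of_card_lt_card (by rw [huniv]; omega)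
  obtain ⟨t₂, -, ht₂⟩ : ∃ t, t ∈ univ ∧ t ∉ F₁ ∪ F₁.image (fun z => bxor z t₁) :=
    exists_mem_notMem_of_card_lt_card (by
      have h1 := card_union_le F₁ (F₁.image (fun z => bxor z t₁))
      have h2 : #(F₁.image (fun z => bxor z t₁)) ≤ 1536 := card_image_le.trans hF₁card
      rw [huniv]; omega)
  rw [mem_union, not_or] at ht₂
  refine ⟨t₁, t₂, fun ε => ⟨hgood t₁ ht₁ ε, hgood t₂ ht₂.1 ε, ?_⟩⟩
  rw [iw_bxor_assoc]; exact hgood _ (hshift t₂ t₁ ht₂.2) ε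

/-! ### (H3) on `Z` -/

/-- **(H3) on the 9-flat, unconditionally in the position of the bad points.**  Cubic `f, g`, `W_g = 64u''`, `Z = {u'' even} = x_Z ⊕ V₀`
a 9-flat, `e = u'' − (−1)^f` with `Σ_{x ∉ Z} e² ≤ 256`: every parametrised 3-flat sum of `e` inside `Z` is `≡ 0 (mod 4)` (5-flat
`F ⊕ ⟨t₁,t₂⟩` whose three translates avoid `Z` and `A = {4 ∤ e}`; there `4 ∣ e`). [this work] -/
theorem gh_H3 (f g : (Fin (6 + 6) → Bool) → Bool) (hf : IsDegLeFun 3 f) (hg : IsDegLeFun 3 g)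
    (u'' : (Fin (6 + 6) → Bool) → ℤ) (hu'' : ∀ x, W (fun y => signOf (g y)) x = (2 : ℝ) ^ 6 * (u'' x : ℝ))
    (V₀ : Finset (Fin (6 + 6) → Bool)) (xZ : Fin (6 + 6) → Bool) (h0 : zeroVec ∈ V₀)
    (hadd : ∀ a ∈ V₀, ∀ b ∈ V₀, bxor a b ∈ V₀) (hcardV : #V₀ = 512)
    (hS : (univ.filter fun x : Fin (6 + 6) → Bool => ¬ Odd (u'' x)) = V₀.image (bxor xZ))
    (hoff : ∑ y ∈ univ.filter (fun y => y ∉ (univ.filter fun x : Fin (6 + 6) → Bool => ¬ Odd (u'' x))), (u'' y - sZ (f y)) ^ 2 ≤ 256) :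
    ∀ x ∈ (univ.filter fun x : Fin (6 + 6) → Bool => ¬ Odd (u'' x)), ∀ a b c : Fin (6 + 6) → Bool,
      a ∈ V₀ → b ∈ V₀ → c ∈ V₀ →
      (4 : ℤ) ∣ ∑ ε : Fin 3 → Bool, (u'' (fun j => x j ^^ decide (Odd #(univ.filter fun i =>
        ε i && (![a, b, c] : Fin 3 → Fin (6 + 6) → Bool) i j))) - sZ (f (fun j => x j ^^ decide (Odd #(univ.filter fun i =>
        ε i && (![a, b, c] : Fin 3 → Fin (6 + 6) → Bool) i j))))) := by
  classical
  set Z := univ.filter (fun x : Fin (6 + 6) → Bool => ¬ Odd (u'' x)) with hZdef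
  set e : (Fin (6 + 6) → Bool) → ℤ := fun x => u'' x - sZ (f x) with hedef
  intro x hx a b c ha hb hc
  show (4 : ℤ) ∣ ∑ ε : Fin 3 → Bool, e (fun j => x j ^^ decide (Odd #(univ.filter fun i =>
        ε i && (![a, b, c] : Fin 3 → Fin (6 + 6) → Bool) i j)))
  set A := (univ.filter fun y : Fin (6 + 6) → Bool => y ∉ Z ∧ ¬ (4 : ℤ) ∣ u'' y - sZ (f y)) with hAdef
  have hAcard : #A ≤ 64 := by
    have h := gh_A_card f u''
    have h' : (4 : ℤ) * #A ≤ 256 := h.trans hoff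
    have : (#A : ℤ) ≤ 64 := by linarith
    exact_mod_cast this
  have hPV : ∀ x, x ∈ Z → ∀ a ∈ V₀, bxor x a ∈ Z := fun x hx a ha => fl1_coset_vadd hadd hS hx ha
  -- the truncation `F'` agrees with `e` mod 4 and vanishes at the good points
  set F' : (Fin (6 + 6) → Bool) → ℤ := fun y => if (y ∈ Z ∨ ¬ (4 : ℤ) ∣ e y) then e y else 0 with hF'
  have hdiffF : ∀ y, (4 : ℤ) ∣ e y - F' y := by
    intro y
    by_cases hy : (y ∈ Z ∨ ¬ (4 : ℤ) ∣ e y)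
    · simp only [F', if_pos hy, sub_self]; exact dvd_zero _
    · simp only [F', if_neg hy, sub_zero]
      rw [not_or, not_not] at hy
      exact hy.2
  have hF'Z : ∀ y, y ∈ Z → F' y = e y := fun y hy => by simp only [F', if_pos (Or.inl hy)]
  have hGF : ∀ y, y ∉ Z → y ∉ A → F' y = 0 := by
    intro y hy hyA
    have h4 : (4 : ℤ) ∣ e y := by
      by_contra h4
      exact hyA (mem_filter.2 ⟨mem_univ _, hy, h4⟩)
    simp only [F']
    rw [if_neg]
    rw [not_or, not_not]
    exact ⟨hy, h4⟩
  -- the inner 3-flat and two avoiding directions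
  set pt : (Fin 3 → Bool) → (Fin (6 + 6) → Bool) :=
    fun ε => (fun j => x j ^^ decide (Odd #(univ.filter fun i => ε i && (![a, b, c] : Fin 3 → Fin (6 + 6) → Bool) i j))) with hptdef
  have hin : ∀ ε, pt ε ∈ Z := fun ε => fr_mem_flatPt3 V₀ h0 (· ∈ Z) hPV hx ![a, b, c] (fun i => by fin_cases i <;> assumption) ε
  obtain ⟨t₁, t₂, hgood⟩ := gh_avoid2 V₀ Z xZ hadd hcardV hS A hAcard (k := 3) (by norm_num) pt hin
  have hloc := sp_loc2 F' x t₁ t₂ ![a, b, c]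
    (fun ε => hGF _ (hgood ε).1.1 (hgood ε).1.2) (fun ε => hGF _ (hgood ε).2.1.1 (hgood ε).2.1.2)
    (fun ε => hGF _ (hgood ε).2.2.1 (hgood ε).2.2.2)
  -- the 5-flat sum of `F'` is `≡ 0 (mod 4)`
  have h5 := gh_flat5 f g hf hg u'' hu'' x ![t₁, t₂, a, b, c]
  have h5' : (4 : ℤ) ∣ ∑ ε : Fin 5 → Bool, F' (fun j => x j ^^ decide (Odd #(univ.filter fun i =>
      ε i && (![t₁, t₂, a, b, c] : Fin 5 → Fin (6 + 6) → Bool) i j))) := by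
    have hd : (4 : ℤ) ∣ ∑ ε : Fin 5 → Bool, ((u'' (fun j => x j ^^ decide (Odd #(univ.filter fun i =>
        ε i && (![t₁, t₂, a, b, c] : Fin 5 → Fin (6 + 6) → Bool) i j))) - sZ (f (fun j => x j ^^ decide (Odd #(univ.filter fun i =>
        ε i && (![t₁, t₂, a, b, c] : Fin 5 → Fin (6 + 6) → Bool) i j))))) -
        F' (fun j => x j ^^ decide (Odd #(univ.filter fun i =>
        ε i && (![t₁, t₂, a, b, c] : Fin 5 → Fin (6 + 6) → Bool) i j)))) := dvd_sum fun ε _ => hdiffF _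
    rw [sum_sub_distrib] at hd
    have := dvd_sub h5 hd
    simpa using this
  rw [hloc] at h5'
  rw [sum_congr rfl fun ε _ => hF'Z _ (hin ε)] at h5'
  exact h5'

/-! ### The LINE congruence on off-`Z` 4-flats -/

/-- **Every 4-flat with directions in `V₀` has residual sum `≡ 0 (mod 4)`** — in particular every 4-flat inside an off-`Z` coset.  Cubic
`f, g`, `W_g = 64u''`, `Z = {u'' even} = x_Z ⊕ V₀` a 9-flat, `Σ_{x ∉ Z} e² ≤ 256`; for ANY base point `b` and `a₀,…,a₃ ∈ V₀`:
`4 ∣ Σ_{ε∈𝔽₂⁴} e(b ⊕ ε·a)`.  (6-flat `x_Z ⊕ ⟨x_Z ⊕ b, t₂, a⟩`: the base 4-flat in `Z` is `≡ 0 (mod 4)` by (H3) twice, the `t₂`- and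
`t₂t₁`-translates avoid `Z ∪ A`.) [this work] -/
theorem gh_line (f g : (Fin (6 + 6) → Bool) → Bool) (hf : IsDegLeFun 3 f) (hg : IsDegLeFun 3 g)
    (u'' : (Fin (6 + 6) → Bool) → ℤ) (hu'' : ∀ x, W (fun y => signOf (g y)) x = (2 : ℝ) ^ 6 * (u'' x : ℝ))
    (V₀ : Finset (Fin (6 + 6) → Bool)) (xZ : Fin (6 + 6) → Bool) (h0 : zeroVec ∈ V₀)
    (hadd : ∀ a ∈ V₀, ∀ b ∈ V₀, bxor a b ∈ V₀) (hcardV : #V₀ = 512)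
    (hS : (univ.filter fun x : Fin (6 + 6) → Bool => ¬ Odd (u'' x)) = V₀.image (bxor xZ))
    (hoff : ∑ y ∈ univ.filter (fun y => y ∉ (univ.filter fun x : Fin (6 + 6) → Bool => ¬ Odd (u'' x))), (u'' y - sZ (f y)) ^ 2 ≤ 256)
    (b : Fin (6 + 6) → Bool)
    (a₀ a₁ a₂ a₃ : Fin (6 + 6) → Bool) (ha₀ : a₀ ∈ V₀) (ha₁ : a₁ ∈ V₀) (ha₂ : a₂ ∈ V₀) (ha₃ : a₃ ∈ V₀) :
    (4 : ℤ) ∣ ∑ ε : Fin 4 → Bool, (u'' (fun j => b j ^^ decide (Odd #(univ.filter fun i =>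
        ε i && (![a₀, a₁, a₂, a₃] : Fin 4 → Fin (6 + 6) → Bool) i j))) - sZ (f (fun j => b j ^^ decide (Odd #(univ.filter fun i =>
        ε i && (![a₀, a₁, a₂, a₃] : Fin 4 → Fin (6 + 6) → Bool) i j))))) := by
  classical
  set Z := univ.filter (fun x : Fin (6 + 6) → Bool => ¬ Odd (u'' x)) with hZdef
  set e : (Fin (6 + 6) → Bool) → ℤ := fun x => u'' x - sZ (f x) with hedef
  show (4 : ℤ) ∣ ∑ ε : Fin 4 → Bool, e (fun j => b j ^^ decide (Odd #(univ.filter fun i =>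
        ε i && (![a₀, a₁, a₂, a₃] : Fin 4 → Fin (6 + 6) → Bool) i j)))
  set A := (univ.filter fun y : Fin (6 + 6) → Bool => y ∉ Z ∧ ¬ (4 : ℤ) ∣ u'' y - sZ (f y)) with hAdef
  have hAcard : #A ≤ 64 := by
    have h := gh_A_card f u''
    have h' : (4 : ℤ) * #A ≤ 256 := h.trans hoff
    have : (#A : ℤ) ≤ 64 := by linarith
    exact_mod_cast this
  have hxZ : xZ ∈ Z := by rw [hS]; exact mem_image.2 ⟨zeroVec, h0, bxor_zeroVec xZ⟩
  have hPV : ∀ x, x ∈ Z → ∀ a ∈ V₀, bxor x a ∈ Z := fun x hx a ha => fl1_coset_vadd hadd hS hx ha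
  have H3 := gh_H3 f g hf hg u'' hu'' V₀ xZ h0 hadd hcardV hS hoff
  -- the truncation
  set F' : (Fin (6 + 6) → Bool) → ℤ := fun y => if (y ∈ Z ∨ ¬ (4 : ℤ) ∣ e y) then e y else 0 with hF'
  have hdiffF : ∀ y, (4 : ℤ) ∣ e y - F' y := by
    intro y
    by_cases hy : (y ∈ Z ∨ ¬ (4 : ℤ) ∣ e y)
    · simp only [F', if_pos hy, sub_self]; exact dvd_zero _
    · simp only [F', if_neg hy, sub_zero]
      rw [not_or, not_not] at hy
      exact hy.2
  have hF'Z : ∀ y, y ∈ Z → F' y = e y := fun y hy => by simp only [F', if_pos (Or.inl hy)]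
  have hGF : ∀ y, y ∉ Z → y ∉ A → F' y = 0 := by
    intro y hy hyA
    have h4 : (4 : ℤ) ∣ e y := by
      by_contra h4
      exact hyA (mem_filter.2 ⟨mem_univ _, hy, h4⟩)
    simp only [F']
    rw [if_neg]
    rw [not_or, not_not]
    exact ⟨hy, h4⟩
  -- the inner 4-flat in `Z` and its translate by `t₁ = x_Z ⊕ b`
  set pt : (Fin 4 → Bool) → (Fin (6 + 6) → Bool) :=
    fun ε => (fun j => xZ j ^^ decide (Odd #(univ.filter fun i => ε i && (![a₀, a₁, a₂, a₃] : Fin 4 → Fin (6 + 6) → Bool) i j)))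
    with hptdef
  have hin : ∀ ε, pt ε ∈ Z := fun ε => fr_mem_flatPt4 V₀ h0 (· ∈ Z) hPV hxZ ![a₀, a₁, a₂, a₃] (fun i => by fin_cases i <;> assumption) ε
  set t₁ := bxor xZ b with ht₁
  have htr : ∀ ε, bxor (pt ε) t₁ = (fun j => b j ^^ decide (Odd #(univ.filter fun i =>
      ε i && (![a₀, a₁, a₂, a₃] : Fin 4 → Fin (6 + 6) → Bool) i j))) := by
    intro ε
    simp only [pt, t₁]
    rw [ws_flatPt_eq_bxor xZ, ws_flatPt_eq_bxor b]
    funext j; simp only [bxor]; cases xZ j <;> cases b j <;> simp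
  -- the second direction `t₂`: the families `pt ⊕ t₂` and `pt ⊕ t₂ ⊕ t₁` must avoid `Z ∪ A` — forbid `F₁ ∪ F₁ ⊕ t₁`
  set Bad₀ := (univ : Finset (Fin 4 → Bool)).biUnion (fun ε => A.image (bxor (pt ε))) with hBad₀
  have hBad₀card : #Bad₀ ≤ 1024 := by
    calc #Bad₀ ≤ ∑ ε : Fin 4 → Bool, #(A.image (bxor (pt ε))) := card_biUnion_le
      _ ≤ ∑ ε : Fin 4 → Bool, #A := sum_le_sum fun ε _ => card_image_le
      _ = 2 ^ 4 * #A := by rw [sum_const, card_univ, Fintype.card_fun, Fintype.card_bool, Fintype.card_fin, smul_eq_mul]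
      _ ≤ 16 * 64 := Nat.mul_le_mul (le_refl _) hAcard
      _ = 1024 := by norm_num
  set F₁ := V₀ ∪ Bad₀ with hF₁
  have hF₁card : #F₁ ≤ 1536 := (card_union_le _ _).trans (by rw [hcardV]; omega)
  have hgoodF : ∀ w, w ∉ F₁ → ∀ ε, bxor (pt ε) w ∉ Z ∧ bxor (pt ε) w ∉ A := by
    intro w hw ε
    rw [hF₁, mem_union, not_or] at hw
    refine ⟨fun h => hw.1 (gh_mem_dir V₀ Z xZ hadd hS (hin ε) h), fun h => hw.2 ?_⟩
    exact mem_biUnion.2 ⟨ε, mem_univ _, mem_image.2 ⟨bxor (pt ε) w, h, bxor_bxor_cancel_left _ _⟩⟩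
  have huniv : #(univ : Finset (Fin (6 + 6) → Bool)) = 4096 := by
    rw [card_univ, Fintype.card_fun, Fintype.card_bool, Fintype.card_fin]; norm_num
  obtain ⟨t₂, -, ht₂⟩ : ∃ t, t ∈ univ ∧ t ∉ F₁ ∪ F₁.image (fun z => bxor z t₁) :=
    exists_mem_notMem_of_card_lt_card (by
      have h1 := card_union_le F₁ (F₁.image (fun z => bxor z t₁))
      have h2 : #(F₁.image (fun z => bxor z t₁)) ≤ 1536 := card_image_le.trans hF₁card
      rw [huniv]; omega)
  rw [mem_union, not_or] at ht₂
  have ht₂₁ : bxor t₂ t₁ ∉ F₁ := fun hmem =>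
    ht₂.2 (mem_image.2 ⟨bxor t₂ t₁, hmem, by rw [iw_bxor_assoc, bxor_self, bxor_zeroVec]⟩)
  -- 6-flat sum with directions `t₁, t₂, a₀..a₃`, peeled twice
  have h6 := tw15_e_flat6 f g hf hg u'' hu'' xZ ![t₁, t₂, a₀, a₁, a₂, a₃]
  have h6' : (4 : ℤ) ∣ ∑ ε : Fin 6 → Bool, F' (fun j => xZ j ^^ decide (Odd #(univ.filter fun i =>
      ε i && (![t₁, t₂, a₀, a₁, a₂, a₃] : Fin 6 → Fin (6 + 6) → Bool) i j))) := by
    have hd : (4 : ℤ) ∣ ∑ ε : Fin 6 → Bool, ((u'' (fun j => xZ j ^^ decide (Odd #(univ.filter fun i =>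
        ε i && (![t₁, t₂, a₀, a₁, a₂, a₃] : Fin 6 → Fin (6 + 6) → Bool) i j))) - sZ (f (fun j => xZ j ^^ decide (Odd #(univ.filter fun i =>
        ε i && (![t₁, t₂, a₀, a₁, a₂, a₃] : Fin 6 → Fin (6 + 6) → Bool) i j))))) -
        F' (fun j => xZ j ^^ decide (Odd #(univ.filter fun i =>
        ε i && (![t₁, t₂, a₀, a₁, a₂, a₃] : Fin 6 → Fin (6 + 6) → Bool) i j)))) := dvd_sum fun ε _ => hdiffF _
    rw [sum_sub_distrib] at hd
    have := dvd_sub h6 hd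
    simpa using this
  have hpeel : ∑ ε : Fin 6 → Bool, F' (fun j => xZ j ^^ decide (Odd #(univ.filter fun i =>
      ε i && (![t₁, t₂, a₀, a₁, a₂, a₃] : Fin 6 → Fin (6 + 6) → Bool) i j))) =
      (∑ ε : Fin 4 → Bool, F' (pt ε) + ∑ ε : Fin 4 → Bool, F' (bxor (pt ε) t₂)) +
      (∑ ε : Fin 4 → Bool, F' (bxor (pt ε) t₁) + ∑ ε : Fin 4 → Bool, F' (bxor (bxor (pt ε) t₂) t₁)) := by
    have p1 := fr_sum_peel F' xZ t₁ ![t₂, a₀, a₁, a₂, a₃]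
    have p2 := fr_sum_peel F' xZ t₂ ![a₀, a₁, a₂, a₃]
    have p3 := fr_sum_peel (fun y => F' (bxor y t₁)) xZ t₂ ![a₀, a₁, a₂, a₃]
    beta_reduce at p3
    rw [p1, p2, p3]
  have hz2 : ∑ ε : Fin 4 → Bool, F' (bxor (pt ε) t₂) = 0 :=
    sum_eq_zero fun ε _ => hGF _ (hgoodF t₂ ht₂.1 ε).1 (hgoodF t₂ ht₂.1 ε).2
  have hz21 : ∑ ε : Fin 4 → Bool, F' (bxor (bxor (pt ε) t₂) t₁) = 0 := by
    refine sum_eq_zero fun ε _ => ?_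
    rw [iw_bxor_assoc]
    exact hGF _ (hgoodF _ ht₂₁ ε).1 (hgoodF _ ht₂₁ ε).2
  -- the base 4-flat in `Z` is `≡ 0 (mod 4)` by (H3) twice
  have hbase : (4 : ℤ) ∣ ∑ ε : Fin 4 → Bool, F' (pt ε) := by
    rw [sum_congr rfl fun ε _ => hF'Z _ (hin ε)]
    have p := fr_sum_peel e xZ a₀ ![a₁, a₂, a₃]
    simp only [pt]
    rw [p]
    refine dvd_add (H3 xZ hxZ a₁ a₂ a₃ ha₁ ha₂ ha₃) ?_
    have hx' : bxor xZ a₀ ∈ Z := hPV xZ hxZ a₀ ha₀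
    have h3 := H3 (bxor xZ a₀) hx' a₁ a₂ a₃ ha₁ ha₂ ha₃
    have e3 : ∀ ε : Fin 3 → Bool, bxor (fun j => xZ j ^^ decide (Odd #(univ.filter fun i =>
        ε i && (![a₁, a₂, a₃] : Fin 3 → Fin (6 + 6) → Bool) i j))) a₀ =
        (fun j => (bxor xZ a₀) j ^^ decide (Odd #(univ.filter fun i =>
        ε i && (![a₁, a₂, a₃] : Fin 3 → Fin (6 + 6) → Bool) i j))) := by
      intro ε
      rw [ws_flatPt_eq_bxor xZ, ws_flatPt_eq_bxor (bxor xZ a₀)]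
      funext j; simp only [bxor]; cases xZ j <;> cases a₀ j <;> simp
    rw [sum_congr rfl fun ε _ => congrArg e (e3 ε)]
    exact h3
  rw [hpeel, hz2, hz21, add_zero, add_zero] at h6'
  have htarget : (4 : ℤ) ∣ ∑ ε : Fin 4 → Bool, F' (bxor (pt ε) t₁) := by
    have h := dvd_sub h6' hbase
    rwa [add_sub_cancel_left] at h
  -- back from `F'` to `e` on the target flat
  have hd : (4 : ℤ) ∣ ∑ ε : Fin 4 → Bool, (e (bxor (pt ε) t₁) - F' (bxor (pt ε) t₁)) := dvd_sum fun ε _ => hdiffF _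
  rw [sum_sub_distrib] at hd
  have h := dvd_add htarget hd
  rw [add_sub_cancel] at h
  rw [sum_congr rfl fun ε _ => congrArg e (htr ε)] at h
  exact h

end Summit.QuantumAdvantage.QuantumAdvantage.Theorems.CubicForrelation.NearExactIsExact

end
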